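import Summits.QuantumFields.YangMills.Theorems.UnitScaleTiltFluctuationComparisonRegPrLiftFaceAssembly

/-!
# Route `UnitScaleTilt` — crux K1bR-pr `FluctuationComparisonRegPr` (stmt-QuantumFields-19201), stub `stub_oneStepSmallLift`
# (W7 line), piece (L1)→(L2) kernel data: «ANSATZ S» — ONE SYMBOLIC FACE-SUPPORTED, S-NEUTRAL, RADIUS-1 KERNEL TABLE FOR EVERY BLOCK
# SIZE `L`, in the tree coordinates of layer F4 (`ApproxLift.FaceSupported/SNeutral/RowMass`) (support file `--supports stmt-QuantumFields-19201`)

Cell `ym3-torus` (rung R3), seat `ym3-torus-p2` gen 10; memo `HOME/IR-NODE.md` §16.5 and CARD-19201-oneStepSmallLift-v3 §A (gen 9: the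
face-supported family settled; LP-optimal within the ansatz, kit j260410; this file's companion `…AnsatzSRowBound` proves the row bound
`λ_S(L) = L/(5L−12)` modulo coarse 2-boundaries of mass `(L−2)/(5L−12)`, so `λ_S√L < 1` exactly for odd `5 ≤ L ≤ 19`).

THE TABLE (`R = 1`).  On the EXIT bond of direction `a` of a block (in-block offset `p_a = L−1`) at transverse offsets `p`, the Lie-algebra
correction couples to the coarse plaquettes of the two orientations `o ∋ a`; writing `ν′` for the other direction of `o` and `q = p_{ν′}`:
`kz a p o k = ±( [kvec k = 0]·φ₀(q) + [kvec k = −e_{ν′}]·φ₋₁(q) )`, sign `+` iff `a = o.1` (antisymmetry of the orientation), with the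
profiles (on OFFSETS `q ∈ {0,…,L−1}`, `α = 1/(5L−12)`): `φ₀ = (0, α, …, α, −(L−2)α)`, `φ₋₁ = ((L−2)α, −α, …, −α, 0)` (`φ₋₁(q) = −φ₀(L−1−q)`).

* §1 profiles, their values and `Σ_q φ₀(q) = Σ_q φ₋₁(q) = 0`;
* §2 the table `kzS P` (any dimension), `FaceSupported`, `SNeutral` (face sums factor through the transverse offset), `RowMass 12(L−2)α`;
* §3 the EVALUATION of a kernel row against an orientation/displacement-indexed field: `Σ_{o,k} kz a p o k • w o (s + kvec k)` collapses to
  `[p_a = L−1]·Σ_o (±)(φ₀(q) • w o s + φ₋₁(q) • w o (s − e_{ν′}))` (`eval_row`), the input of the row-bound casework.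

Elementary; nothing of Bałaban's is asserted.
-/

noncomputable section

open scoped BigOperators Matrix.Norms.L2Operator
open NormedSpace

namespace Summit.QuantumFields.YangMills.Theorems.ApproxLift.AnsatzS

open Literature.MathematicalPhysics.QuantumFieldTheory.Balaban1983to89
open T4Continuum BlockAveraging

/-! ## §1 The profiles -/

/-- `α(L) = 1/(5L − 12)`. -/
def alpha (L : ℕ) : ℝ := 1 / (5 * (L : ℝ) - 12)

/-- `φ₀` on in-block offsets: `0` at `q = 0`, `−(L−2)α` at `q = L−1`, `α` in between. -/
def phi0 (L : ℕ) (q : ℕ) : ℝ := if q = 0 then 0 else if q = L - 1 then -(((L : ℝ) - 2) * alpha L) else alpha L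

/-- `φ₋₁(q) = −φ₀(L−1−q)`: `(L−2)α` at `q = 0`, `0` at `q = L−1`, `−α` in between. -/
def phim1 (L : ℕ) (q : ℕ) : ℝ := if q = 0 then ((L : ℝ) - 2) * alpha L else if q = L - 1 then 0 else -alpha L

/-- `0 < α` for `L ≥ 3`. -/
theorem alpha_pos {L : ℕ} (hL : 3 ≤ L) : 0 < alpha L := by
  unfold alpha; have : (3 : ℝ) ≤ L := by exact_mod_cast hL
  exact div_pos one_pos (by linarith)

/-- `α·(5L − 12) = 1` (`L ≥ 3`). -/
theorem alpha_mul {L : ℕ} (hL : 3 ≤ L) : alpha L * (5 * (L : ℝ) - 12) = 1 := by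
  unfold alpha; have : (3 : ℝ) ≤ L := by exact_mod_cast hL
  have h : (5 * (L : ℝ) - 12) ≠ 0 := by linarith
  field_simp

/-- `1 − 4(L−2)α = (L−4)α`. -/
theorem one_sub_four_mul_alpha {L : ℕ} (hL : 3 ≤ L) : 1 - 4 * (((L : ℝ) - 2) * alpha L) = ((L : ℝ) - 4) * alpha L := by
  linear_combination (-1 : ℝ) * alpha_mul hL

/-- `φ₀(0) = 0`. -/
theorem phi0_zero (L : ℕ) : phi0 L 0 = 0 := by simp [phi0]
/-- `φ₀(L−1) = −(L−2)α`. -/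
theorem phi0_last {L : ℕ} (hL : 3 ≤ L) : phi0 L (L - 1) = -(((L : ℝ) - 2) * alpha L) := by
  unfold phi0; rw [if_neg (by omega), if_pos rfl]
/-- `φ₀(q) = α` in between. -/
theorem phi0_mid {L q : ℕ} (h0 : q ≠ 0) (h1 : q ≠ L - 1) : phi0 L q = alpha L := by
  unfold phi0; rw [if_neg h0, if_neg h1]
/-- `φ₋₁(0) = (L−2)α`. -/
theorem phim1_zero (L : ℕ) : phim1 L 0 = ((L : ℝ) - 2) * alpha L := by simp [phim1]
/-- `φ₋₁(L−1) = 0`. -/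
theorem phim1_last {L : ℕ} (hL : 3 ≤ L) : phim1 L (L - 1) = 0 := by
  unfold phim1; rw [if_neg (by omega), if_pos rfl]
/-- `φ₋₁(q) = −α` in between. -/
theorem phim1_mid {L q : ℕ} (h0 : q ≠ 0) (h1 : q ≠ L - 1) : phim1 L q = -alpha L := by
  unfold phim1; rw [if_neg h0, if_neg h1]

/-- `|φ₀(q)| ≤ (L−2)α` (`L ≥ 3`). -/
theorem abs_phi0_le {L : ℕ} (hL : 3 ≤ L) (q : ℕ) : |phi0 L q| ≤ ((L : ℝ) - 2) * alpha L := by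
  have ha := alpha_pos hL
  have h3 : (3 : ℝ) ≤ L := by exact_mod_cast hL
  have hM : alpha L ≤ ((L : ℝ) - 2) * alpha L := by nlinarith
  have hM0 : 0 ≤ ((L : ℝ) - 2) * alpha L := mul_nonneg (by linarith) ha.le
  unfold phi0; split_ifs
  · rw [abs_zero]; exact hM0
  · rw [abs_neg, abs_of_nonneg hM0]
  · rw [abs_of_pos ha]; exact hM

/-- `|φ₋₁(q)| ≤ (L−2)α` (`L ≥ 3`). -/
theorem abs_phim1_le {L : ℕ} (hL : 3 ≤ L) (q : ℕ) : |phim1 L q| ≤ ((L : ℝ) - 2) * alpha L := by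
  have ha := alpha_pos hL
  have h3 : (3 : ℝ) ≤ L := by exact_mod_cast hL
  have hM : alpha L ≤ ((L : ℝ) - 2) * alpha L := by nlinarith
  have hM0 : 0 ≤ ((L : ℝ) - 2) * alpha L := mul_nonneg (by linarith) ha.le
  unfold phim1; split_ifs
  · rw [abs_of_nonneg hM0]
  · rw [abs_zero]; exact hM0
  · rw [abs_neg, abs_of_pos ha]; exact hM

/-- `Σ_{q<L} φ₀(q) = 0`. -/
theorem sum_phi0 {L : ℕ} (hL : 3 ≤ L) : ∑ q ∈ Finset.range L, phi0 L q = 0 := by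
  obtain ⟨M, rfl⟩ : ∃ M, L = M + 2 := ⟨L - 2, by omega⟩
  rw [Finset.sum_range_succ, Finset.sum_range_succ']
  have hmid : ∀ q ∈ Finset.range M, phi0 (M + 2) (q + 1) = alpha (M + 2) := fun q hq => by
    rw [Finset.mem_range] at hq; exact phi0_mid (by omega) (by omega)
  rw [Finset.sum_congr rfl hmid, Finset.sum_const, Finset.card_range, phi0_zero,
    show M + 1 = M + 2 - 1 from by omega, phi0_last hL]
  push_cast; ring

/-- `Σ_{q<L} φ₋₁(q) = 0`. -/
theorem sum_phim1 {L : ℕ} (hL : 3 ≤ L) : ∑ q ∈ Finset.range L, phim1 L q = 0 := by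
  obtain ⟨M, rfl⟩ : ∃ M, L = M + 2 := ⟨L - 2, by omega⟩
  rw [Finset.sum_range_succ, Finset.sum_range_succ']
  have hmid : ∀ q ∈ Finset.range M, phim1 (M + 2) (q + 1) = -alpha (M + 2) := fun q hq => by
    rw [Finset.mem_range] at hq; exact phim1_mid (by omega) (by omega)
  rw [Finset.sum_congr rfl hmid, Finset.sum_const, Finset.card_range, phim1_zero,
    show M + 1 = M + 2 - 1 from by omega, phim1_last hL]
  push_cast; ring

/-! ## §2 The table, face support, S-neutrality, row mass -/

/-- `k₀`: the coarse displacement `0` (`kvec 1 k₀ = 0`). -/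
def k0 {d : ℕ} : Fin d → Fin (2 * 1 + 1) := fun _ => 1

/-- `k₋(ν)`: the coarse displacement `−e_ν` (`kvec 1 (k₋ ν) = −e_ν`). -/
def km {d : ℕ} (ν : Fin d) : Fin d → Fin (2 * 1 + 1) := Function.update k0 ν 0

/-- `kvec 1 k₀ = 0`. -/
theorem kvec_k0 {d : ℕ} : kvec 1 (k0 : Fin d → Fin (2 * 1 + 1)) = 0 := by
  funext i; simp [kvec, k0]

/-- `kvec 1 (k₋ ν) = −e_ν`. -/
theorem kvec_km {d : ℕ} (ν : Fin d) : kvec 1 (km ν) = -unitZ ν := by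
  funext i; unfold kvec km k0 unitZ
  by_cases h : i = ν
  · subst h; simp
  · rw [Function.update_of_ne h]; simp [h]

/-- The coefficient block of transverse offset `q` and transverse direction `ν`: `[k = k₀]·φ₀(q) + [k = k₋(ν)]·φ₋₁(q)`. -/
def coef (L : ℕ) (q : ℕ) {d : ℕ} (ν : Fin d) (k : Fin d → Fin (2 * 1 + 1)) : ℝ :=
  (if k = k0 then phi0 L q else 0) + (if k = km ν then phim1 L q else 0)

/-- **ANSATZ S** (any dimension; radius `R = 1`): on an exit bond of direction `a`, couple to the orientations `o ∋ a` with the sign of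
`a` in `o`, through the transverse offset `p_{ν′}`. -/
def kzS (P : Params) : Fin P.d → (Fin P.d → Fin P.L) → Orient P.d → (Fin P.d → Fin (2 * 1 + 1)) → ℝ :=
  fun a p o k =>
    if (p a : ℕ) = P.L - 1 then
      (if a = o.1.1 then coef P.L (p o.1.2) o.1.2 k else 0) - (if a = o.1.2 then coef P.L (p o.1.1) o.1.1 k else 0)
    else 0

variable {P : Params}

/-- **FACE SUPPORT.** -/
theorem faceSupported : FaceSupported 1 (kzS P) := fun a p o k h => by
  unfold kzS; rw [if_neg h]

/-- `Σ_k |coef q ν k| ≤ |φ₀ q| + |φ₋₁ q|`. -/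
theorem sum_abs_coef_le (L q : ℕ) {d : ℕ} (ν : Fin d) :
    ∑ k : Fin d → Fin (2 * 1 + 1), |coef L q ν k| ≤ |phi0 L q| + |phim1 L q| := by
  calc _ ≤ ∑ k : Fin d → Fin (2 * 1 + 1), (|if k = k0 then phi0 L q else 0| + |if k = km ν then phim1 L q else 0|) :=
        Finset.sum_le_sum fun k _ => abs_add_le _ _
    _ = |phi0 L q| + |phim1 L q| := by
        rw [Finset.sum_add_distrib]
        congr 1
        · rw [Finset.sum_eq_single k0 (fun k _ hk => by rw [if_neg hk, abs_zero]) (fun h => (h (Finset.mem_univ _)).elim), if_pos rfl]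
        · rw [Finset.sum_eq_single (km ν) (fun k _ hk => by rw [if_neg hk, abs_zero]) (fun h => (h (Finset.mem_univ _)).elim),
            if_pos rfl]

/-- **ROW MASS** `K₁ = 4d²(L−2)α` (`L ≥ 3`; crude: at most `d²` orientations, each at most `2·2·(L−2)α`). -/
theorem rowMass (hL : 3 ≤ P.L) : RowMass 1 (kzS P) (4 * (P.d : ℝ) ^ 2 * (((P.L : ℝ) - 2) * alpha P.L)) := by
  intro a p
  set M : ℝ := ((P.L : ℝ) - 2) * alpha P.L with hM
  have hM0 : 0 ≤ M := by
    have := alpha_pos hL; have h3 : (3 : ℝ) ≤ P.L := by exact_mod_cast hL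
    rw [hM]; nlinarith
  have hrow : ∀ o : Orient P.d, ∑ k : Fin P.d → Fin (2 * 1 + 1), |kzS P a p o k| ≤ 4 * M := by
    intro o
    by_cases hp : (p a : ℕ) = P.L - 1
    · have h1 : ∀ (c : Prop) [Decidable c] (q : ℕ) (ν : Fin P.d),
          ∑ k : Fin P.d → Fin (2 * 1 + 1), |if c then coef P.L q ν k else 0| ≤ 2 * M := by
        intro c _ q ν
        by_cases hc : c
        · simp_rw [if_pos hc]
          exact (sum_abs_coef_le _ _ _).trans (by linarith [abs_phi0_le hL q, abs_phim1_le hL q])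
        · simp_rw [if_neg hc, abs_zero, Finset.sum_const_zero]; linarith
      calc _ ≤ ∑ k : Fin P.d → Fin (2 * 1 + 1), (|if a = o.1.1 then coef P.L (p o.1.2) o.1.2 k else 0| +
              |if a = o.1.2 then coef P.L (p o.1.1) o.1.1 k else 0|) := Finset.sum_le_sum fun k _ => by
              unfold kzS; rw [if_pos hp]; exact abs_sub _ _
        _ ≤ 2 * M + 2 * M := by rw [Finset.sum_add_distrib]; exact add_le_add (h1 _ _ _) (h1 _ _ _)
        _ = 4 * M := by ring
    · have : ∀ k, kzS P a p o k = 0 := fun k => by unfold kzS; rw [if_neg hp]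
      simp_rw [this, abs_zero, Finset.sum_const_zero]; linarith
  calc _ ≤ ∑ _o : Orient P.d, 4 * M := Finset.sum_le_sum fun o _ => hrow o
    _ = (Fintype.card (Orient P.d) : ℝ) * (4 * M) := by rw [Finset.sum_const, nsmul_eq_mul, Finset.card_univ]
    _ ≤ (P.d : ℝ) ^ 2 * (4 * M) := by
        refine mul_le_mul_of_nonneg_right ?_ (by linarith)
        have h := Fintype.card_subtype_le (fun mn : Fin P.d × Fin P.d => mn.1 < mn.2)
        rw [Fintype.card_prod, Fintype.card_fin] at h
        exact_mod_cast (show Fintype.card (Orient P.d) ≤ P.d ^ 2 by rw [sq]; exact h)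
    _ = 4 * (P.d : ℝ) ^ 2 * M := by ring

/-- `Σ_{q<L} coef q ν k = 0` (each profile sums to zero). -/
theorem sum_coef_fin {L : ℕ} (hL : 3 ≤ L) {d : ℕ} (ν : Fin d) (k : Fin d → Fin (2 * 1 + 1)) :
    ∑ q : Fin L, coef L q ν k = 0 := by
  unfold coef
  rw [Finset.sum_add_distrib]
  have h0 : ∑ q : Fin L, (if k = k0 then phi0 L q else 0) = 0 := by
    split_ifs
    · rw [Fin.sum_univ_eq_sum_range (fun q => phi0 L q), sum_phi0 hL]
    · exact Finset.sum_const_zero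
  have h1 : ∑ q : Fin L, (if k = km ν then phim1 L q else 0) = 0 := by
    split_ifs
    · rw [Fin.sum_univ_eq_sum_range (fun q => phim1 L q), sum_phim1 hL]
    · exact Finset.sum_const_zero
  rw [h0, h1, add_zero]

/-- A sum over all offset vectors of a function of ONE coordinate with vanishing profile sum vanishes. -/
theorem sum_coef_coord (hL : 3 ≤ P.L) (ν : Fin P.d) (k : Fin P.d → Fin (2 * 1 + 1)) :
    ∑ r : Fin P.d → Fin P.L, coef P.L (r ν) ν k = 0 := by
  rw [Fintype.sum_equiv (Equiv.funSplitAt ν (Fin P.L)) (fun r => coef P.L (r ν) ν k) (fun qr => coef P.L qr.1 ν k)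
    (fun r => rfl), Fintype.sum_prod_type]
  simp only [Finset.sum_const, Finset.card_univ]
  rw [← Finset.smul_sum, sum_coef_fin hL, smul_zero]

/-- **S-NEUTRALITY**: the face sums of the table vanish (`L ≥ 3`). -/
theorem sNeutral (hL : 3 ≤ P.L) : SNeutral 1 (kzS P) := by
  intro a o k
  have ho : o.1.1 ≠ o.1.2 := ne_of_lt o.2
  have key : ∀ r : Fin P.d → Fin P.L, kzS P a (Function.update r a (lastPos P)) o k =
      (if a = o.1.1 then coef P.L (r o.1.2) o.1.2 k else 0) - (if a = o.1.2 then coef P.L (r o.1.1) o.1.1 k else 0) := by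
    intro r
    unfold kzS
    rw [Function.update_self, if_pos (show ((lastPos P : Fin P.L) : ℕ) = P.L - 1 from rfl)]
    congr 1
    · by_cases h : a = o.1.1
      · rw [if_pos h, if_pos h, Function.update_of_ne (by rw [h]; exact ho.symm)]
      · rw [if_neg h, if_neg h]
    · by_cases h : a = o.1.2
      · rw [if_pos h, if_pos h, Function.update_of_ne (by rw [h]; exact ho)]
      · rw [if_neg h, if_neg h]
  simp_rw [key]
  rw [Finset.sum_sub_distrib]
  have hz : ∀ (c : Prop) [Decidable c] (ν : Fin P.d), (∑ r : Fin P.d → Fin P.L, if c then coef P.L (r ν) ν k else 0) = 0 := by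
    intro c _ ν
    by_cases hc : c
    · simp_rw [if_pos hc]; exact sum_coef_coord hL ν k
    · simp_rw [if_neg hc]; exact Finset.sum_const_zero
  rw [hz, hz, sub_zero]

/-! ## §3 Evaluation of a kernel row against an orientation/displacement-indexed field -/

section Eval

variable {M : Type*} [AddCommGroup M] [Module ℂ M]

/-- Casting an indicator coefficient through `ℝ → ℂ` and the scalar action. -/
theorem ite_cast_smul (c : Prop) [Decidable c] (x : ℝ) (X : M) :
    (((if c then x else 0 : ℝ)) : ℂ) • X = if c then ((x : ℝ) : ℂ) • X else 0 := by
  by_cases h : c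
  · rw [if_pos h, if_pos h]
  · rw [if_neg h, if_neg h, Complex.ofReal_zero, zero_smul]

/-- `Σ_k coef(q, ν, k) • X k = φ₀(q) • X k₀ + φ₋₁(q) • X (k₋ ν)`. -/
theorem sum_coef_smul (L q : ℕ) {d : ℕ} (ν : Fin d) (X : (Fin d → Fin (2 * 1 + 1)) → M) :
    ∑ k, ((coef L q ν k : ℝ) : ℂ) • X k = ((phi0 L q : ℝ) : ℂ) • X k0 + ((phim1 L q : ℝ) : ℂ) • X (km ν) := by
  unfold coef
  simp_rw [Complex.ofReal_add, add_smul, Finset.sum_add_distrib, ite_cast_smul, Finset.sum_ite_eq', Finset.mem_univ, if_true]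

/-- **ROW EVALUATION** (shifted block): `Σ_{o,k} kz a p o k • w o (s + kvec k)` is, on an exit bond (`p_a = L−1`), the sum over the
orientations `o ∋ a` of `±(φ₀(p_{ν′}) • w o s + φ₋₁(p_{ν′}) • w o (s − e_{ν′}))`, and `0` otherwise. -/
theorem eval_row (a : Fin P.d) (p : Fin P.d → Fin P.L) (w : Orient P.d → (Fin P.d → ℤ) → M) (s : Fin P.d → ℤ) :
    ∑ o : Orient P.d, ∑ k : Fin P.d → Fin (2 * 1 + 1), ((kzS P a p o k : ℝ) : ℂ) • w o (s + kvec 1 k) =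
      if (p a : ℕ) = P.L - 1 then
        ∑ o : Orient P.d,
          ((if a = o.1.1 then ((phi0 P.L (p o.1.2) : ℝ) : ℂ) • w o s + ((phim1 P.L (p o.1.2) : ℝ) : ℂ) • w o (s - unitZ o.1.2)
            else 0) -
           (if a = o.1.2 then ((phi0 P.L (p o.1.1) : ℝ) : ℂ) • w o s + ((phim1 P.L (p o.1.1) : ℝ) : ℂ) • w o (s - unitZ o.1.1)
            else 0))
      else 0 := by
  by_cases hp : (p a : ℕ) = P.L - 1
  · rw [if_pos hp]
    refine Finset.sum_congr rfl fun o _ => ?_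
    have hk : ∀ k, kzS P a p o k = (if a = o.1.1 then coef P.L (p o.1.2) o.1.2 k else 0) -
        (if a = o.1.2 then coef P.L (p o.1.1) o.1.1 k else 0) := fun k => by unfold kzS; rw [if_pos hp]
    simp_rw [hk, Complex.ofReal_sub, sub_smul, Finset.sum_sub_distrib]
    congr 1
    · by_cases h : a = o.1.1
      · simp_rw [if_pos h]; rw [sum_coef_smul, kvec_k0, kvec_km, add_zero, ← sub_eq_add_neg]
      · simp_rw [if_neg h]; simp
    · by_cases h : a = o.1.2
      · simp_rw [if_pos h]; rw [sum_coef_smul, kvec_k0, kvec_km, add_zero, ← sub_eq_add_neg]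
      · simp_rw [if_neg h]; simp
  · rw [if_neg hp]
    have hk : ∀ o k, kzS P a p o k = 0 := fun o k => by unfold kzS; rw [if_neg hp]
    simp [hk]

/-- **ROW EVALUATION** (own block, `s = 0`). -/
theorem eval_row₀ (a : Fin P.d) (p : Fin P.d → Fin P.L) (w : Orient P.d → (Fin P.d → ℤ) → M) :
    ∑ o : Orient P.d, ∑ k : Fin P.d → Fin (2 * 1 + 1), ((kzS P a p o k : ℝ) : ℂ) • w o (kvec 1 k) =
      if (p a : ℕ) = P.L - 1 then
        ∑ o : Orient P.d,
          ((if a = o.1.1 then ((phi0 P.L (p o.1.2) : ℝ) : ℂ) • w o 0 + ((phim1 P.L (p o.1.2) : ℝ) : ℂ) • w o (-unitZ o.1.2)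
            else 0) -
           (if a = o.1.2 then ((phi0 P.L (p o.1.1) : ℝ) : ℂ) • w o 0 + ((phim1 P.L (p o.1.1) : ℝ) : ℂ) • w o (-unitZ o.1.1)
            else 0))
      else 0 := by
  have h := eval_row a p w 0
  simp only [zero_add, zero_sub] at h
  exact h

end Eval

end Summit.QuantumFields.YangMills.Theorems.ApproxLift.AnsatzS

end
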